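/-
Copyright (c) 2026. All rights reserved.
Released under Apache 2.0 license as described in the file LICENSE.
Authors: HodgeCM publication cell (pub-hodgecm), GR lane, seat GR-1 (`pub-hodgecm-own-real34`).
-/
import Literature.NumberTheory.GelbartRogawski1991.DoubledUnitaryArchSiegelRealSign
import Literature.NumberTheory.GelbartRogawski1991.DoubledUnitaryArchSiegelDiagonalModulusReal
import Literature.NumberTheory.GelbartRogawski1991.QuadExtSplittingCharArchRealPlaces
import Literature.NumberTheory.Weil1964.ArchActQuadraticPlaces
import HarnessLib

/-!
# The archimedean twist at the REAL places of `E` (type (ii)): `χ̃_w(det g_w) = χ_w(u_w) · χ_{c⁻¹w}(u_{c⁻¹w})` on `P_Δ`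

Topic `NumberTheory/GelbartRogawski1991`; namespace `Literature.NumberTheory.GelbartRogawski1991.GRConstructionGen`
(telescope of `DoubledUnitaryGlobalSplittingDataGen`).  One small definition with body (`archComponentR`, the real twin of
`QuadExtSplittingCharArchTwistComplex.archComponentC`) and theorems; no `def … : Prop`, no named fact, no `sorry`.

At a real place `v` of `F` SPLIT in `E` the two places `w, c⁻¹w` of `E` over `v` are real, `U(J^𝔻)(F_v) ≅ GL_{n+n}(ℝ) ∋ g_w`,
and for `(g, 1) ∈ P_Δ(𝔸)` with `u = det_Δ (g,1)` (Kudla's `x`) one has `det g_w · σ(u_{c⁻¹w}) = σ(u_w)`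
(`DoubledUnitaryArchSiegelRealSign.det_evalR_mul_det_deltaBlock_eq`).  With the local splitting identity at the pair,
`χ_w(ι t) · χ_{c⁻¹ w}(ι t) = 1` for `t ∈ F_v` (`QuadExtSplittingCharArchRealPlaces`, `χ|_{𝕀_F} = ε_{E/F}^m`), this gives:

* `archComponentR χ w : ℝˣ →* ℂˣ` (`χ̃_w := χ_w ∘ σ_w⁻¹`), `archComponentR_map`, `continuous_archComponentR`;
* `archComponentR_mul_archComponentR_smul_inv` — `χ̃_w(t) · χ̃_{c⁻¹w}(t) = 1`;
* **`archComponentR_det_evalR_eq`** — `χ̃_w(det g_w) = χ_w(u_w) · χ_{c⁻¹ w}(u_{c⁻¹ w})` on `P_Δ`: the factor of `χ(det_Δ (g,1))`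
  at the pair `{w, c⁻¹w}` is the value at `g` of the continuous character `χ̃_w ∘ det ∘ (·)_w` of `U(J^𝔻)(E ⊗ ℝ)` — EXACTLY,
  not only up to squares — which is the type-(ii) factor `η₂` of the twisting character of the archimedean half
  (`DoubledWeilRepresentationArchLiftReps`, `hηS`).

([GelbartRogawski1991, §3.1 p. 456 (3.1.2)]; [Kudla1994, §3], case `E_v = F_v ⊕ F_v`; [HarrisKudlaSweet1996, §1 (1.15)].)
Written for the stage-1 cell `pub-hodgecm` (seat GR-1); nothing here is a claim of the manuscripts adjudicated by that cell.

## References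

* S. Gelbart, J. Rogawski, Invent. Math. 105 (1991), §3.1 p. 456 (3.1.2) [GelbartRogawski1991].
* S. S. Kudla, Israel J. Math. 87 (1994), §3 [Kudla1994].
* M. Harris, S. S. Kudla, W. J. Sweet, J. Amer. Math. Soc. 9 (1996), §1 (1.15) [HarrisKudlaSweet1996].
* J. Tate, *Fourier analysis in number fields and Hecke's zeta-functions* (1950/1967), §4.3 [TateThesis1967].
-/

set_option autoImplicit false

noncomputable section

open scoped Classical
open scoped Matrix
open NumberField NumberField.InfinitePlace NumberField.mixedEmbedding IsDedekindDomain
open Literature.NumberTheory.Automorphic Literature.NumberTheory.Automorphic.UnitaryGroup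
open Literature.NumberTheory.Weil1964
open Literature.NumberTheory.GaloisRepresentations
open Literature.RepresentationTheory.HeisenbergGroup
open Literature.RepresentationTheory.HarrisKudlaSweet1996
open Literature.NumberTheory.QuadraticForms (ideleInfiniteComponent val_ideleInfiniteComponent)
open Literature.NumberTheory.GelbartRogawski1991.UnitaryDualPair.ArchSplitting.QuadExt

namespace Literature.NumberTheory.GelbartRogawski1991.GRConstructionGen

open UnitaryDualPair

/-! ## §1 `χ̃_w := χ_w ∘ σ_w⁻¹ : ℝˣ →* ℂˣ` at a real place `w` -/

section Component

variable (F : Type) [Field F] [NumberField F] (E : Type) [Field E] [NumberField E] [Algebra F E]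
  (c : E ≃ₐ[F] E)

/-- **`χ̃_w := χ_w ∘ σ_w⁻¹ : ℝˣ →* ℂˣ`** — the archimedean component of `χ` at the REAL place `w` in the real coordinate
`σ_w : E_w ≅ ℝ`. [cite: TateThesis1967, §4.3] -/
def archComponentR (χ : HeckeCharacter E) (w : {w : InfinitePlace E // w.IsReal}) : ℝˣ →* ℂˣ :=
  (χ.archComponent w.1).comp (Units.map (Completion.ringEquivRealOfIsReal w.2).symm.toRingHom.toMonoidHom)

omit [NumberField F] [Algebra F E] in
/-- `χ̃_w` is continuous. [cite: TateThesis1967, §4.3] -/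
theorem continuous_archComponentR (χ : HeckeCharacter E) (w : {w : InfinitePlace E // w.IsReal}) :
    Continuous (archComponentR E χ w) :=
  (continuous_archComponent χ w.1).comp
    (Continuous.units_map _ (Completion.isometryEquivRealOfIsReal w.2).symm.continuous)

omit [NumberField F] [Algebra F E] in
/-- `χ̃_w (σ_w y) = χ_w(y)`. [cite: TateThesis1967, §4.3] -/
theorem archComponentR_map (χ : HeckeCharacter E) (w : {w : InfinitePlace E // w.IsReal}) (y : (w.1.Completion)ˣ) :
    archComponentR E χ w (Units.map (Completion.extensionEmbeddingOfIsReal w.2).toMonoidHom y) = χ.archComponent w.1 y := by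
  have h : Units.map (Completion.ringEquivRealOfIsReal w.2).symm.toRingHom.toMonoidHom
      (Units.map (Completion.extensionEmbeddingOfIsReal w.2).toMonoidHom y) = y := by
    apply Units.ext
    change (Completion.ringEquivRealOfIsReal w.2).symm
      (Completion.extensionEmbeddingOfIsReal w.2 (y : w.1.Completion)) = (y : w.1.Completion)
    rw [← Completion.ringEquivRealOfIsReal_apply w.2, RingEquiv.symm_apply_apply]
  simp only [archComponentR, MonoidHom.comp_apply, h]

/-- **`χ̃_w(t) · χ̃_{c⁻¹ w}(t) = 1`** for `t ∈ ℝˣ` at a real place `w` of `E` (`χ|_{𝕀_F} = ε_{E/F}^m`, `c ≠ 1`): the two places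
over the split real place `v = w|_F` are `c⁻¹w` and `c (c⁻¹ w) = w`, and `t = σ_v(x)` for `x ∈ F_vˣ`.
[cite: GelbartRogawski1991, §3.1 p. 456 (3.1.2)] -/
theorem archComponentR_mul_archComponentR_smul_inv [Algebra.IsQuadraticExtension F E] {m : ℕ} {χ : HeckeCharacter E}
    (hχ : IsSplittingCharExt F E m χ) (hc : c ≠ 1) {δ : E} (hcδ : c δ = -δ) (hδ : δ ≠ 0)
    (w : {w : InfinitePlace E // w.IsReal}) (t : ℝˣ) :
    archComponentR E χ w t * archComponentR E χ ⟨c⁻¹ • w.1, isReal_smul_iff.mpr w.2⟩ t = 1 := by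
  -- the place `w' = c⁻¹ w` is real over the same `v`, and `c • w' = w`
  set w' : {w : InfinitePlace E // w.IsReal} := ⟨c⁻¹ • w.1, isReal_smul_iff.mpr w.2⟩ with hw'
  have hcw' : c • w'.1 = w.1 := smul_inv_smul c w.1
  have hv : (w'.1.comap (algebraMap F E)).IsReal := w'.2.comap _
  -- `t = σ_v x`
  set x₀ : (w'.1.comap (algebraMap F E)).Completion := (Completion.ringEquivRealOfIsReal hv).symm (t : ℝ) with hx₀
  have hx₀t : Completion.extensionEmbeddingOfIsReal hv x₀ = (t : ℝ) := by
    rw [hx₀, ← Completion.ringEquivRealOfIsReal_apply hv, RingEquiv.apply_symm_apply]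
  have hx₀0 : x₀ ≠ 0 := by
    intro h
    rw [h, map_zero] at hx₀t
    exact t.ne_zero hx₀t.symm
  set x : ((w'.1.comap (algebraMap F E)).Completion)ˣ := Units.mk0 x₀ hx₀0 with hx
  have key := hχ.archComponent_mul_archComponent_smul_of_isReal c w' hc hcδ hδ x
  -- the two images of `x` read in `ℝ` are `t`
  have h1 : ∀ (w₁ : InfinitePlace E) (hw₁ : w₁.IsReal) (hover : w₁.comap (algebraMap F E) = w'.1.comap (algebraMap F E)),
      Units.map (Completion.extensionEmbeddingOfIsReal hw₁).toMonoidHom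
        (Units.map (toInfPlace E (w'.1.comap (algebraMap F E)) ⟨w₁, hover⟩).toMonoidHom x) = t := by
    intro w₁ hw₁ hover
    apply Units.ext
    apply Complex.ofReal_injective
    change ((Completion.extensionEmbeddingOfIsReal hw₁ (toInfPlace E (w'.1.comap (algebraMap F E)) ⟨w₁, hover⟩ x₀) : ℝ) : ℂ) = _
    rw [Completion.extensionEmbeddingOfIsReal_apply,
      extensionEmbedding_toInfPlace_of_isReal F E (w'.1.comap (algebraMap F E)) hv ⟨w₁, hover⟩, hx₀t]
  have e1 : χ.archComponent w'.1 (Units.map (toInfPlace E (w'.1.comap (algebraMap F E)) ⟨w'.1, rfl⟩).toMonoidHom x) =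
      archComponentR E χ w' t := by
    rw [← h1 w'.1 w'.2 rfl, archComponentR_map]
  have e2 : χ.archComponent (c • w'.1)
      (Units.map (toInfPlace E (w'.1.comap (algebraMap F E)) ⟨c • w'.1, comap_smul_eq' F E c w'.1⟩).toMonoidHom x) =
      archComponentR E χ w t := by
    have hreal : (c • w'.1).IsReal := isReal_smul_iff.mpr w'.2
    have h2 := h1 (c • w'.1) hreal (comap_smul_eq' F E c w'.1)
    rw [← archComponentR_map E χ ⟨c • w'.1, hreal⟩, h2]
    congr 1
    exact congrArg (archComponentR E χ) (Subtype.ext hcw')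
  rw [e1, e2, mul_comm] at key
  exact key

end Component

/-! ## §2 `χ̃_w(det g_w) = χ_w(u_w) · χ_{c⁻¹w}(u_{c⁻¹w})` on `P_Δ` -/

section Doubled

variable (F : Type) [Field F] [NumberField F] (E : Type) [Field E] [NumberField E] [Algebra F E]
  [Algebra.IsQuadraticExtension F E]
variable (c : E ≃ₐ[F] E) {δ : E} (hcδ : c δ = -δ) (hδ : δ ≠ 0) {d : F} (hd : δ * δ = algebraMap F E d)
variable {N M n : ℕ} (e : Fin N × Fin M ≃ Fin n)
  (TV : Matrix (Fin N) (Fin N) F) (hV : TV.IsSymm) (hVd : IsUnit TV.det)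
  (TW : Matrix (Fin M) (Fin M) F) (hW : TW.IsSymm) (hWd : IsUnit TW.det)

include hVd hWd hcδ hδ in
/-- **`χ̃_w(det g_w) = χ_w(u_w) · χ_{c⁻¹ w}(u_{c⁻¹ w})`** for `(g, 1) ∈ P_Δ(𝔸)`, `u = det_Δ (g,1)`, at every real place `w` of `E`
(`χ|_{𝕀_F} = ε_{E/F}^m`, `c` an involution `≠ 1`): the type-(ii) factor of `χ(det_Δ (g,1))` is the value at `g` of the
continuous character `χ̃_w ∘ det ∘ (·)_w`. [cite: GelbartRogawski1991, §3.1 p. 456 (3.1.2)] [cite: Kudla1994, §3] -/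
theorem archComponentR_det_evalR_eq (hc : c ≠ 1) (hcc : c * c = 1) {m : ℕ} {χ : HeckeCharacter E} (hχ : IsSplittingCharExt F E m χ)
    (g : arch F E c (n + n) (hermD F E e TV TW))
    (hS : IsSiegelDelta F E c e TV TW (UnitaryGroup.archToAdelic F E c (n + n) (hermD F E e TV TW) g))
    (u : ideleGroup E)
    (hu : ((u : ideleGroup E) : AdeleRing (𝓞 E) E) = detDelta F E c e TV TW (UnitaryGroup.archToAdelic F E c (n + n) (hermD F E e TV TW) g))
    (w : {w : InfinitePlace E // w.IsReal}) :
    archComponentR E χ w (Units.map (evalR E w : mixedSpace E →+* ℝ).toMonoidHom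
        (Matrix.GeneralLinearGroup.det (g : GL (Fin (n + n)) (mixedSpace E)))) =
      χ.archComponent w.1 (ideleInfiniteComponent E w.1 u) *
        χ.archComponent (c⁻¹ • w.1) (ideleInfiniteComponent E (c⁻¹ • w.1) u) := by
  set w' : {w : InfinitePlace E // w.IsReal} := ⟨c⁻¹ • w.1, isReal_smul_iff.mpr w.2⟩ with hw'
  -- the two real coordinates of `u`: `x_w = σ_w(u_w)`, `x_{w'} = σ_{w'}(u_{w'})`
  have hx : ∀ w₁ : {w : InfinitePlace E // w.IsReal},
      (archMat E (Fin n) (deltaBlock F E c e TV TW (UnitaryGroup.archToAdelic F E c (n + n) (hermD F E e TV TW) g))).det.1 w₁ =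
        Completion.extensionEmbeddingOfIsReal w₁.2 ((ideleInfiniteComponent E w₁.1 u : (w₁.1.Completion)ˣ) : w₁.1.Completion) := by
    intro w₁
    rw [det_archMat_fst, val_ideleInfiniteComponent, hu]
    rfl
  have hne : ∀ w₁ : {w : InfinitePlace E // w.IsReal},
      Completion.extensionEmbeddingOfIsReal w₁.2 ((ideleInfiniteComponent E w₁.1 u : (w₁.1.Completion)ˣ) : w₁.1.Completion) ≠ 0 :=
    fun w₁ => (map_ne_zero _).2 (ideleInfiniteComponent E w₁.1 u).ne_zero
  -- the real units `a = det g_w`, `x_w`, `x_{w'}` and `a · x_{w'} = x_w`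
  have key := det_evalR_mul_det_deltaBlock_eq F E c e TV hVd TW hWd hcc g hS w
  rw [hx w, hx w'] at key
  have hdet : Units.map (evalR E w : mixedSpace E →+* ℝ).toMonoidHom (Matrix.GeneralLinearGroup.det (g : GL (Fin (n + n)) (mixedSpace E))) *
      Units.map (Completion.extensionEmbeddingOfIsReal w'.2).toMonoidHom (ideleInfiniteComponent E w'.1 u) =
        Units.map (Completion.extensionEmbeddingOfIsReal w.2).toMonoidHom (ideleInfiniteComponent E w.1 u) := by
    apply Units.ext
    simp only [Units.val_mul, Units.coe_map, RingHom.toMonoidHom_eq_coe, MonoidHom.coe_coe,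
      Matrix.GeneralLinearGroup.val_det_apply, RingHom.map_det, RingHom.mapMatrix_apply]
    exact key
  -- apply `χ̃_w`: `χ̃_w(a) · χ̃_w(x_{w'}) = χ_w(u_w)`, and `χ̃_w(x_{w'}) = χ̃_{w'}(x_{w'})⁻¹ = χ_{w'}(u_{w'})⁻¹`
  have h1 := congrArg (archComponentR E χ w) hdet
  rw [map_mul, archComponentR_map] at h1
  have h2 : archComponentR E χ w (Units.map (Completion.extensionEmbeddingOfIsReal w'.2).toMonoidHom (ideleInfiniteComponent E w'.1 u)) =
      (χ.archComponent w'.1 (ideleInfiniteComponent E w'.1 u))⁻¹ := by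
    rw [← archComponentR_map E χ w', eq_inv_iff_mul_eq_one]
    exact archComponentR_mul_archComponentR_smul_inv F E c hχ hc hcδ hδ w _
  rw [h2] at h1
  change _ = _ * χ.archComponent w'.1 (ideleInfiniteComponent E w'.1 u)
  rw [← h1, inv_mul_cancel_right]

end Doubled

end Literature.NumberTheory.GelbartRogawski1991.GRConstructionGen

end
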